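import Summits.ValiantsHypothesis.ValiantsHypothesis.Theorems.SymPencilPerFourInnerRankSlotA
import Summits.ValiantsHypothesis.ValiantsHypothesis.Theorems.SymPencilPerFourInnerRankTenPairs

/-!
# Route `SymPencil` — inner rank of the `2 | 2` row split of `per_4`: all four slots of a
# `≤ 11`-square joint family are one-sided of rank `≤ 1`
# (`--supports` stmt-ValiantsHypothesis-5674 `SdcSuperquadratic`; (8,8) column of the size tables,
# isotropic-kernel route, bridge step (B4) of memo `NOTE-p6g15-5674-IR12-reduction.md` §8)

`SymPencilPerFourInnerRankSlotA.slotA_rank_le_one` transported along the symmetries of the joint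
identity `Σ_r c_r t_r((a,b),(y₂,y₃))² = per (a; b; y₂; y₃)`:

* `TenPairs.hJ_swap` (`a ↔ b`) ⇒ `slotB_rank_le_one`: for every `b`, the `y₂`-block of
  the `b`-part `y₂ ↦ (t_r((0,b),(y₂,0)))_r` has rank `≤ 1`, or for every `b` the `y₃`-block has;
* `hJ_transpose` (`(a,b) ↔ (y₂,y₃)`, `per_swap_pairs`) ⇒ `slotY₂_rank_le_one`,
  `slotY₃_rank_le_one`: for every `y₂`, `a ↦ (t_r((a,0),(y₂,0)))_r` has rank `≤ 1` or for every
  `y₂`, `b ↦ (t_r((0,b),(y₂,0)))_r` has; same for `y₃`.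

Next (memo §3, step (B5)): the rank kills and the normal form, reducing the cells `(8,8,10)`,
`(8,8,11)` to the pure problem P1.  Honest framing: conditional reduction machinery; no cell
closes; the window `27 ≤ sdc(per_4) ≤ 29`, the crux and `VP ≠ VNP` are untouched.  No
definitions, no named facts. [folklore]
-/

noncomputable section

-- single-conjunct layout: Sub = Summit, duplicated namespace component intended
set_option linter.dupNamespace false

namespace Summit.ValiantsHypothesis.ValiantsHypothesis.Theorems.SymPencilPerFourInnerRankSlots

open Matrix Finset Module
open Summit.ValiantsHypothesis.ValiantsHypothesis.Theorems.SymPencilPerFourInnerRankRows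
open Summit.ValiantsHypothesis.ValiantsHypothesis.Theorems.SymPencilPerFourInnerRankSlotA
open Summit.ValiantsHypothesis.ValiantsHypothesis.Theorems.SymPencilPerFourInnerRankTenPairs

variable {K : Type*} [Field K] {ι : Type*} [Fintype ι]

omit [Fintype ι] in
/-- `per` is invariant under exchanging the row pairs `(a,b) ↔ (v,w)`. [folklore] -/
theorem per_swap_pairs (a b v w : Fin 4 → K) :
    (Matrix.of ![v, w, a, b]).permanent = (Matrix.of ![a, b, v, w]).permanent := by
  simp only [permanent_of_rows]; ring

/-- **Transposition symmetry `(a,b) ↔ (y₂,y₃)`.** [folklore] -/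
theorem hJ_transpose (c : ι → K)
    (t : ι → (((Fin 4 → K) × (Fin 4 → K)) →ₗ[K] ((Fin 4 → K) × (Fin 4 → K)) →ₗ[K] K))
    (hJ : ∀ a b y₂ y₃ : Fin 4 → K,
      ∑ r, c r * (t r (a, b) (y₂, y₃)) ^ 2 = (Matrix.of ![a, b, y₂, y₃]).permanent) :
    ∀ a b y₂ y₃ : Fin 4 → K,
      ∑ r, c r * ((t r).flip (a, b) (y₂, y₃)) ^ 2 = (Matrix.of ![a, b, y₂, y₃]).permanent := by
  intro a b y₂ y₃
  have h := hJ y₂ y₃ a b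
  rw [per_swap_pairs] at h
  simpa using h

/-- **The `b`-slot is one-sided of rank `≤ 1`.** [folklore] -/
theorem slotB_rank_le_one [CharZero K] [DecidableEq ι] (hι : Fintype.card ι ≤ 11)
    (c : ι → K) (hc : ∀ r, c r ≠ 0)
    (t : ι → (((Fin 4 → K) × (Fin 4 → K)) →ₗ[K] ((Fin 4 → K) × (Fin 4 → K)) →ₗ[K] K))
    (hJ : ∀ a b y₂ y₃ : Fin 4 → K,
      ∑ r, c r * (t r (a, b) (y₂, y₃)) ^ 2 = (Matrix.of ![a, b, y₂, y₃]).permanent) :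
    (∀ (b x x' : Fin 4 → K) (r r' : ι),
      t r (0, b) (x, 0) * t r' (0, b) (x', 0) - t r (0, b) (x', 0) * t r' (0, b) (x, 0) = 0) ∨
    (∀ (b x x' : Fin 4 → K) (r r' : ι),
      t r (0, b) (0, x) * t r' (0, b) (0, x') - t r (0, b) (0, x') * t r' (0, b) (0, x) = 0) := by
  have h := slotA_rank_le_one hι c hc _ (hJ_swap c t hJ)
  simpa using h

/-- **The `y₂`-slot is one-sided of rank `≤ 1`.** [folklore] -/
theorem slotY₂_rank_le_one [CharZero K] [DecidableEq ι] (hι : Fintype.card ι ≤ 11)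
    (c : ι → K) (hc : ∀ r, c r ≠ 0)
    (t : ι → (((Fin 4 → K) × (Fin 4 → K)) →ₗ[K] ((Fin 4 → K) × (Fin 4 → K)) →ₗ[K] K))
    (hJ : ∀ a b y₂ y₃ : Fin 4 → K,
      ∑ r, c r * (t r (a, b) (y₂, y₃)) ^ 2 = (Matrix.of ![a, b, y₂, y₃]).permanent) :
    (∀ (y x x' : Fin 4 → K) (r r' : ι),
      t r (x, 0) (y, 0) * t r' (x', 0) (y, 0) - t r (x', 0) (y, 0) * t r' (x, 0) (y, 0) = 0) ∨
    (∀ (y x x' : Fin 4 → K) (r r' : ι),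
      t r (0, x) (y, 0) * t r' (0, x') (y, 0) - t r (0, x') (y, 0) * t r' (0, x) (y, 0) = 0) := by
  have h := slotA_rank_le_one hι c hc _ (hJ_transpose c t hJ)
  simpa using h

/-- **The `y₃`-slot is one-sided of rank `≤ 1`.** [folklore] -/
theorem slotY₃_rank_le_one [CharZero K] [DecidableEq ι] (hι : Fintype.card ι ≤ 11)
    (c : ι → K) (hc : ∀ r, c r ≠ 0)
    (t : ι → (((Fin 4 → K) × (Fin 4 → K)) →ₗ[K] ((Fin 4 → K) × (Fin 4 → K)) →ₗ[K] K))
    (hJ : ∀ a b y₂ y₃ : Fin 4 → K,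
      ∑ r, c r * (t r (a, b) (y₂, y₃)) ^ 2 = (Matrix.of ![a, b, y₂, y₃]).permanent) :
    (∀ (y x x' : Fin 4 → K) (r r' : ι),
      t r (x, 0) (0, y) * t r' (x', 0) (0, y) - t r (x', 0) (0, y) * t r' (x, 0) (0, y) = 0) ∨
    (∀ (y x x' : Fin 4 → K) (r r' : ι),
      t r (0, x) (0, y) * t r' (0, x') (0, y) - t r (0, x') (0, y) * t r' (0, x) (0, y) = 0) := by
  have h := slotB_rank_le_one hι c hc _ (hJ_transpose c t hJ)
  simpa using h

end Summit.ValiantsHypothesis.ValiantsHypothesis.Theorems.SymPencilPerFourInnerRankSlots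

end
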